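import Literature.AlgebraicGeometry.Motives.UniversalHypersurfaceRegularLocusChartPartial
import Literature.AlgebraicGeometry.Motives.UniversalHypersurfaceRegularLocusChartSubmersion
import Literature.AlgebraicGeometry.HodgeTheory.UniversalHypersurfaceDiscriminant
import Literature.Geometry.ComplexAnalytic.QuadricPencilShellSubmersion
import HarnessLib

/-!
# The coefficient map and the Morse radius are jointly submersive on the Morse shells of a monomial pencil near a node

Family `hodge`, layer `Literature/AlgebraicGeometry/HodgeTheory`; theorems only (no definition, no named fact). Written by the
prover seat `hodge-nonav-prover-Bx` (g14, cell `hodge-nonav`) as a brick of the ODP-ISOTOPY port (memo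
`PROGRAMME-ODP-ISOTOPY-Bx-g13` §2, Picard–Lefschetz binder of crux K1-B, stmt-HodgeConjecture-19716): the generalisation from the
quaternary cyclic-cover pencil `x₃^p = f₁ + c·x₂^p` (prover-Ax's `CyclicCoverPencilChartPartial` ∕ `CyclicCoverPencilJointSubmersion`)
to an ARBITRARY degree-`d` form `F` in `n + 2` variables and the monomial pencil direction `xᵢ^d`, read in the chart `xᵢ ≠ 0` of
the regular locus `𝒴°(ℂ)` of the universal family (`Motives/UniversalHypersurfaceRegularLocusChart*`, generic in `(n, d, i)`).

* §1 `regChartCoeffVec_pencil_regPowIndex_of_isHomogeneous` — **the solved coefficient along the pencil**: at chart coordinates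
  `(b'₀, y)` with `b'₀` the coefficients of `F` off `xᵢ^d`, the coefficient of `xᵢ^d` solved from the equation is
  `coeff_{xᵢ^d} F − F(ins_i 1 y)`; so the PENCIL COORDINATE of a point of `𝒴°(ℂ)ᵢ` over the pencil `F + c·xᵢ^d` is
  `c = −F(ins_i 1 y)`, a polynomial in the affine coordinates `y`, with a non-degenerate critical point at a node of `F` in the
  chart (`OrdinaryDoublePointMorseChart`);
* §2 `surjective_mfderiv_regCoeff_prod_chartRadius` — **joint submersivity of (coefficients, Morse radius) on the shells**: if
  `Θ` is a `C^∞` open partial homeomorphism of `ℂⁿ⁺¹` with `C^∞` inverse such that the solved coefficient is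
  `c₀ + Σⱼ (Θ y)ⱼ²` on `Θ.source` (a holomorphic Morse chart of the pencil coordinate, `HolomorphicMorse.exists_holomorphicMorseChart`),
  `B` a `C^∞` function of the chart coordinates agreeing with `v ↦ Σⱼ|Θ(v_y)ⱼ|²` near `Φᵢ(Q)`, and `Q ∈ 𝒴°(ℂ)ᵢ` has remaining
  coefficients `b'₀`, affine coordinates `y(Q) ∈ Θ.source` with `r₀² ≤ Σ|Θ y|²` and `|b_{xᵢ^d}(Q) − c₀| < r₀²`, then the manifold
  differential at `Q` of `Q' ↦ (b(Q'), regChartExtend n d i B Q')` is onto — the hypothesis `hsurj₂` of the tangent-lift lemma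
  `Geometry/Manifold/SubmersionLiftVectorField` (assembly of `Motives/UniversalHypersurfaceRegularLocusChartSubmersion`,
  `…ChartPartial` and `Geometry/ComplexAnalytic/QuadricPencilShellSubmersion`).

Honest scope: local differential plumbing; nothing here says HC or any rung is proved.

## References

* [VoisinHodgeII2003] C. Voisin, Hodge Theory and Complex Algebraic Geometry II (2003), §2.3 (Lefschetz pencils), §6.2.1.
* [Milnor1968] J. Milnor, Singular Points of Complex Hypersurfaces (1968), §4–§5 (spheres transverse to the fibres), Lemma 5.10.
* [BrockerJanichIDT1982] T. Bröcker, K. Jänich, Introduction to Differential Topology (1982), §5, (8.12).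
-/

noncomputable section

open CategoryTheory AlgebraicGeometry MvPolynomial TopologicalSpace Set Topology Filter
open scoped Manifold ContDiff
open Literature.AlgebraicGeometry.Motives Literature.AlgebraicGeometry.Motives.UniversalHypersurface
open Literature.AlgebraicGeometry.HodgeTheory.UniversalHypersurface Literature.Geometry.ComplexAnalytic
open Literature.NumberTheory.Transcendental

namespace Literature.AlgebraicGeometry.HodgeTheory

variable (n d : ℕ) (i : Fin (n + 2))

/-! ### §1 The solved coefficient along a monomial pencil -/

/-- **The solved coefficient of the chart `xᵢ ≠ 0` along the pencil `F + c·xᵢ^d`**: with `b'₀` the coefficients of the degree-`d`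
form `F` off `xᵢ^d`, for every `y`: `regChartCoeffVec n d i (b'₀, y) (xᵢ^d) = coeff_{xᵢ^d} F − F(ins_i 1 y)` (the equation
`Σ_m b_m (ins_i 1 y)^m = 0` solved for `b_{xᵢ^d}`, and `F(ins_i 1 y) = coeff_{xᵢ^d} F + Σ_{m ≠ xᵢ^d} coeff_m F · (ins_i 1 y)^m`).
[cite: VoisinHodgeII2003, §2.3 and §6.2.1] -/
theorem regChartCoeffVec_pencil_regPowIndex_of_isHomogeneous {F : MvPolynomial (Fin (n + 2)) ℂ} (hF : F.IsHomogeneous d)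
    (y : Fin (n + 1) → ℂ) :
    regChartCoeffVec n d i
        (Sum.elim (fun m : {m : DegIndex n d // m ≠ regPowIndex n d i} => coeffsOf n d F m.1) y) (regPowIndex n d i) =
      MvPolynomial.coeff (Finsupp.single i d) F -
        MvPolynomial.eval (Fin.insertNth i (1 : ℂ) y : Fin (n + 2) → ℂ) F := by
  classical
  set b₀ : DegIndex n d → ℂ := coeffsOf n d F with hb₀
  set w : Fin (n + 2) → ℂ := Fin.insertNth i (1 : ℂ) y with hw
  rw [regChartCoeffVec_regPowIndex]
  -- the full sum is the evaluation of `F = formOfCoeffs b₀` at `w`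
  have hform : formOfCoeffs b₀ = F := by rw [hb₀]; exact formOfCoeffs_coeffsOf n d hF
  have hsum := eval_formOfCoeffs n d b₀ w
  rw [hform, Fintype.sum_eq_add_sum_subtype_ne _ (regPowIndex n d i), prod_regPowIndex] at hsum
  have hwi : w i = 1 := by rw [hw]; exact Fin.insertNth_apply_same (α := fun _ : Fin (n + 2) => ℂ) i (1 : ℂ) y
  rw [hwi, one_pow, mul_one] at hsum
  have hb₀m : b₀ (regPowIndex n d i) = MvPolynomial.coeff (Finsupp.single i d) F := by
    rw [hb₀, coeffsOf_apply]; rfl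
  -- identify the two sums over `{m ≠ xᵢ^d}`
  have hterms : (∑ m' : {m : DegIndex n d // m ≠ regPowIndex n d i},
      Sum.elim (fun m : {m : DegIndex n d // m ≠ regPowIndex n d i} => b₀ m.1) y (Sum.inl m') *
        (m'.1.1.prod fun k e =>
          (Fin.insertNth i (1 : ℂ)
            (fun j => Sum.elim (fun m : {m : DegIndex n d // m ≠ regPowIndex n d i} => b₀ m.1) y (Sum.inr j)) :
            Fin (n + 2) → ℂ) k ^ e)) =
      ∑ m' : {m : DegIndex n d // m ≠ regPowIndex n d i}, b₀ m'.1 * m'.1.1.prod fun k e => w k ^ e := by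
    refine Finset.sum_congr rfl fun m' _ => ?_
    rfl
  rw [hterms]
  linear_combination hsum + hb₀m

/-- The pencil coordinate read off: at a point of `𝒴°(ℂ)ᵢ` whose remaining coefficients are those of `F`, the coefficient of
`xᵢ^d` is `coeff_{xᵢ^d} F − F(ins_i 1 y(Q))`. [cite: VoisinHodgeII2003, §2.3 and §6.2.1] -/
theorem regCoeff_regPowIndex_eq_of_pencil {F : MvPolynomial (Fin (n + 2)) ℂ} (hF : F.IsHomogeneous d)
    {Q : ComplexPoints (regularTotal ℂ n d)} (hQ : Q ∈ regChartDom n d i)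
    (hb' : ∀ m : {m : DegIndex n d // m ≠ regPowIndex n d i}, regChartFun n d i Q (Sum.inl m) = coeffsOf n d F m.1) :
    regCoeff ℂ n d Q (regPowIndex n d i) =
      MvPolynomial.coeff (Finsupp.single i d) F -
        MvPolynomial.eval (Fin.insertNth i (1 : ℂ) (fun j => regChartFun n d i Q (Sum.inr j)) : Fin (n + 2) → ℂ) F := by
  have hv₀ : regChartFun n d i Q =
      Sum.elim (fun m : {m : DegIndex n d // m ≠ regPowIndex n d i} => coeffsOf n d F m.1)
        (fun j => regChartFun n d i Q (Sum.inr j)) := by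
    funext s
    rcases s with m | j
    · exact hb' m
    · rfl
  rw [regCoeff_eq_regChartCoeffVec n d i hQ, hv₀]
  exact regChartCoeffVec_pencil_regPowIndex_of_isHomogeneous n d i hF _

/-! ### §2 Joint submersivity of (coefficients, Morse radius) on the Morse shells -/

/-- **Joint submersivity of (coefficients, Morse radius) on the Morse shells of a monomial pencil near a node.** Let `Θ` be a
`C^∞` open partial homeomorphism of `ℂⁿ⁺¹` with `C^∞` inverse such that, at the fixed remaining coefficients `b'₀`, the solved
coefficient of `xᵢ^d` is `c₀ + Σⱼ (Θ y)ⱼ²` for `y ∈ Θ.source` (a holomorphic Morse chart of the pencil coordinate at a node, critical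
value `c₀`); `B` a `C^∞` real function of the chart coordinates of `𝒴°(ℂ)ᵢ`. If `Q ∈ 𝒴°(ℂ)ᵢ` has remaining coefficients `b'₀`,
affine coordinates `y = y(Q) ∈ Θ.source` with `r₀² ≤ Σⱼ|Θ y|ⱼ²` and `|b_{xᵢ^d}(Q) − c₀| < r₀²` (`0 < r₀`), and `B` agrees with
`v ↦ Σⱼ|Θ(v_y)ⱼ|²` near `Φᵢ(Q)`, then the differential at `Q` of `Q' ↦ (b(Q'), regChartExtend n d i B Q')` is onto.
[cite: Milnor1968, Lemma 5.10] [cite: BrockerJanichIDT1982, §5] -/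
theorem surjective_mfderiv_regCoeff_prod_chartRadius (hd : 0 < d)
    (Θ : OpenPartialHomeomorph (Fin (n + 1) → ℂ) (Fin (n + 1) → ℂ))
    (hΘ : ContDiffOn ℝ ∞ Θ Θ.source) (hΘs : ContDiffOn ℝ ∞ Θ.symm Θ.target)
    (b'₀ : {m : DegIndex n d // m ≠ regPowIndex n d i} → ℂ) (c₀ : ℂ)
    (hΘc : ∀ y ∈ Θ.source,
      regChartCoeffVec n d i (Sum.elim b'₀ y) (regPowIndex n d i) = c₀ + ∑ j, (Θ y j) ^ 2)
    {r₀ : ℝ} (hr₀ : 0 < r₀)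
    (B : (ChartIdx n d i → ℂ) → ℝ) (hB : ContDiff ℝ ∞ B)
    {Q : ComplexPoints (regularTotal ℂ n d)} (hQ : Q ∈ regChartDom n d i)
    (hb' : ∀ m : {m : DegIndex n d // m ≠ regPowIndex n d i}, regChartFun n d i Q (Sum.inl m) = b'₀ m)
    (hy : (fun j => regChartFun n d i Q (Sum.inr j)) ∈ Θ.source)
    (hlow : r₀ ^ 2 ≤ ∑ j, ‖Θ (fun j => regChartFun n d i Q (Sum.inr j)) j‖ ^ 2)
    (hc : ‖regCoeff ℂ n d Q (regPowIndex n d i) - c₀‖ < r₀ ^ 2)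
    (hBloc : B =ᶠ[𝓝 (regChartFun n d i Q)] fun v => ∑ j, ‖Θ (fun j => v (Sum.inr j)) j‖ ^ 2) :
    haveI := locallyOfFiniteType_regularTotal_hom ℂ n d hd
    haveI := smoothOfRelativeDimension_regularTotal_hom ℂ n d hd
    letI := ComplexPoints.chartedSpace (regularTotal ℂ n d) (n + Fintype.card (DegIndex n d))
    Function.Surjective (mfderiv (𝓡 (2 * (n + Fintype.card (DegIndex n d)))) 𝓘(ℝ, (DegIndex n d → ℂ) × ℝ)
      (fun Q' => (regCoeff ℂ n d Q', regChartExtend n d i B Q')) Q) := by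
  -- chart coordinates of `Q`: `v₀ = (b'₀, y)`
  set y : Fin (n + 1) → ℂ := fun j => regChartFun n d i Q (Sum.inr j) with hydef
  have hv₀ : regChartFun n d i Q = Sum.elim b'₀ y := by
    funext s
    rcases s with m | j
    · exact hb' m
    · rfl
  -- the pencil coordinate as a function of `y'` at fixed `b'₀`
  set c : (Fin (n + 1) → ℂ) → ℂ := fun y' => regChartCoeffVec n d i (Sum.elim b'₀ y') (regPowIndex n d i) with hcdef
  have hcQ : regCoeff ℂ n d Q (regPowIndex n d i) = c y := by
    rw [regCoeff_eq_regChartCoeffVec n d i hQ, hv₀]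
  -- Step 1: manifold ⇐ Euclidean in the chart
  refine surjective_mfderiv_pair_of_surjective_fderiv n d i hd B hB hQ ?_
  rw [hv₀]
  -- Step 2: Euclidean ⇐ partial map in `y`
  refine surjective_fderiv_coeffVec_prod_of_partial n d i B b'₀ y ((hB.differentiable (by simp)).differentiableAt) ?_
  -- Step 3: the partial map is `(c, Σ|Θ|²)` near `y`
  have hcont : Continuous fun y' : Fin (n + 1) → ℂ => (Sum.elim b'₀ y' : ChartIdx n d i → ℂ) := by
    refine continuous_pi fun s => ?_
    rcases s with m | j
    · exact continuous_const
    · exact continuous_apply j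
  have hBy : (fun y' : Fin (n + 1) → ℂ => B (Sum.elim b'₀ y')) =ᶠ[𝓝 y] fun y' => ∑ j, ‖Θ y' j‖ ^ 2 := by
    have ht : Tendsto (fun y' : Fin (n + 1) → ℂ => (Sum.elim b'₀ y' : ChartIdx n d i → ℂ)) (𝓝 y)
        (𝓝 (regChartFun n d i Q)) := by
      rw [hv₀]; exact hcont.continuousAt
    filter_upwards [ht.eventually hBloc] with y' hy'
    exact hy'
  have hpartial : (fun y' : Fin (n + 1) → ℂ =>
      (regChartCoeffVec n d i (Sum.elim b'₀ y') (regPowIndex n d i), B (Sum.elim b'₀ y'))) =ᶠ[𝓝 y]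
      fun y' => ((c y' : ℂ), (∑ j, ‖Θ y' j‖ ^ 2 : ℝ)) := by
    filter_upwards [hBy] with y' hy'
    rw [Prod.mk.injEq]
    exact ⟨rfl, hy'⟩
  rw [hpartial.fderiv_eq]
  -- Step 4: `(c − c₀, Σ|Θ|²)` is submersive on the shell (quadric transversality), hence so is `(c, Σ|Θ|²)`
  have hcy : ‖c y - c₀‖ < r₀ ^ 2 := by rw [← hcQ]; exact hc
  have hA := PhamBrieskorn.surjective_fderiv_pencil_quadricRadius_of_shell Θ hΘ hΘs (fun y' => c y' - c₀)
    (fun y' hy' => by rw [hcdef]; simp only [hΘc y' hy']; ring) hr₀ hy hlow hcy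
  have heq : (fun y' : Fin (n + 1) → ℂ => ((c y' : ℂ), (∑ j, ‖Θ y' j‖ ^ 2 : ℝ))) =
      fun y' => (fun y' : Fin (n + 1) → ℂ => ((c y' - c₀ : ℂ), (∑ j, ‖Θ y' j‖ ^ 2 : ℝ))) y' + ((c₀ : ℂ), (0 : ℝ)) := by
    funext y'
    simp
  rw [heq, fderiv_add_const]
  exact hA

end Literature.AlgebraicGeometry.HodgeTheory

end
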